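import Mathlib.Algebra.BigOperators.Fin
import Mathlib.Data.Fin.Tuple.Sort
import Mathlib.Data.List.Basic
import Mathlib.Tactic.FinCases
import Mathlib.Tactic.Ring
import HarnessLib

/-!
# ω-census family (a): no `5 × 5` coset-mass matrix for a slack-4 LP-tight point (finite lemma)

Cell `pub-omega` (unit `pub-omega-tensor-g12`), topic `Summits/MatrixMultiplication/OmegaCensus` (sub-folder `SmallFormats`).
Framing (verbatim): lottery ticket; floor = certified bounds/negative ranges. HONEST FRAMING: an elementary finite statement about
`5 × 5` matrices of natural numbers, decided by a small kernel enumeration; no matrix multiplication content and nothing here is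
progress on `ω`. It is the combinatorial end of the tensor-g12 proof of `NoTightPoint5 4 112` (`MatMul22nRankGF5ThreeNPlusFiveReduction`):
an LP-tight point of the slack-4 X-cap system over `𝔽₅` would have a matrix `N` of point-stabiliser coset masses (natural action of
`PGL₂(5) ≅ S₅` on five letters) with
* `N i j ≡ 2 (mod 3)`, all row and column sums `64`;
* `32 ≤ N i j + N i j' + N i' j + N i' j' ≤ 56` for `i ≠ i'`, `j ≠ j'` (passant caps on the two non-split-torus cosets inside `{g : g·{i,i'} = {j,j'}}`);
* `N i j + N i' j' ≡ N i j' + N i' j (mod 5)` (the cuspidal/Steinberg splitting of the tight point);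
and `no_cosetMatrix5` says no such matrix exists. Proof: with `n = (N − 2)/3` (margins `18`, `2 × 2` block sums in `[8, 16]`, additive
`mod 5`) every row is congruent to the first row shifted by a constant, so the rows live in an explicit short candidate list; after
sorting the first row by a column permutation (`Tuple.sort`), the kernel enumerates sorted first rows (sum `18`, entries `≤ 9`) and
pairwise block-compatible candidate rows (`core5`, `decide +kernel`, a few thousand cheap checks).
-/

namespace Summit.MatrixMultiplication.OmegaCensus.SmallFormats.Coset5

/-- A row of five natural numbers (flat record, cheap for the kernel). -/
structure Row5 where
  /-- entry 0 -/
  a : ℕ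
  /-- entry 1 -/
  b : ℕ
  /-- entry 2 -/
  c : ℕ
  /-- entry 3 -/
  d : ℕ
  /-- entry 4 -/
  e : ℕ
  deriving DecidableEq

/-- Sum of a row. -/
def Row5.sum (r : Row5) : ℕ := r.a + r.b + r.c + r.d + r.e

/-- All nondecreasing rows with sum `18` and entries `≤ 9`. -/
def sortedRows18 : List Row5 :=
  (List.range 10).flatMap fun a => (List.range 10).flatMap fun b => (List.range 10).flatMap fun c =>
    (List.range 10).flatMap fun d =>
      if a ≤ b ∧ b ≤ c ∧ c ≤ d ∧ a + b + c + d ≤ 18 ∧ d ≤ 18 - (a + b + c + d) ∧ 18 - (a + b + c + d) ≤ 9 then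
        [⟨a, b, c, d, 18 - (a + b + c + d)⟩] else []

/-- Completeness of `sortedRows18`. -/
theorem mem_sortedRows18 (r : Row5) (hs : r.sum = 18) (h1 : r.a ≤ r.b) (h2 : r.b ≤ r.c) (h3 : r.c ≤ r.d) (h4 : r.d ≤ r.e)
    (he : r.e ≤ 9) : r ∈ sortedRows18 := by
  obtain ⟨a, b, c, d, e⟩ := r
  simp only [Row5.sum] at hs
  simp only at h1 h2 h3 h4 he
  obtain rfl : e = 18 - (a + b + c + d) := by omega
  simp only [sortedRows18, List.mem_flatMap, List.mem_range]
  refine ⟨a, by omega, b, by omega, c, by omega, d, by omega, ?_⟩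
  rw [if_pos ⟨h1, h2, h3, by omega, by omega, by omega⟩]
  exact List.mem_singleton_self _

/-- All rows with sum `t` (compositions of `t` into five parts). -/
def comps5 (t : ℕ) : List Row5 :=
  (List.range (t + 1)).flatMap fun a => (List.range (t + 1 - a)).flatMap fun b => (List.range (t + 1 - a - b)).flatMap fun c =>
    (List.range (t + 1 - a - b - c)).map fun d => ⟨a, b, c, d, t - a - b - c - d⟩

/-- Completeness of `comps5`. -/
theorem mem_comps5 (r : Row5) {t : ℕ} (hs : r.sum = t) : r ∈ comps5 t := by
  obtain ⟨a, b, c, d, e⟩ := r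
  simp only [Row5.sum] at hs
  obtain rfl : e = t - a - b - c - d := by omega
  simp only [comps5, List.mem_flatMap, List.mem_range, List.mem_map]
  exact ⟨a, by omega, b, by omega, c, by omega, d, by omega, rfl⟩

/-- The residues of `r1 + d` modulo `5`. -/
def shiftBase (r1 : Row5) (d : ℕ) : Row5 :=
  ⟨(r1.a + d) % 5, (r1.b + d) % 5, (r1.c + d) % 5, (r1.d + d) % 5, (r1.e + d) % 5⟩

/-- All rows of sum `18` congruent to the residue row `b` entrywise modulo `5`. -/
def liftRows (b : Row5) : List Row5 :=
  if b.sum ≤ 18 ∧ (18 - b.sum) % 5 = 0 then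
    (comps5 ((18 - b.sum) / 5)).map fun e => ⟨b.a + 5 * e.a, b.b + 5 * e.b, b.c + 5 * e.c, b.d + 5 * e.d, b.e + 5 * e.e⟩
  else []

/-- Candidate rows relative to a first row `r1`: sum `18` and congruent to `r1 + d (mod 5)` entrywise for some `d < 5`. -/
def candRows (r1 : Row5) : List Row5 := (List.range 5).flatMap fun d => liftRows (shiftBase r1 d)

/-- Completeness of `candRows`: a row of sum `18` whose entries are congruent to those of `r1` shifted by `d` is a candidate. -/
theorem mem_candRows (r1 r : Row5) (d : ℕ) (hd : d < 5) (hs : r.sum = 18)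
    (ha : r.a % 5 = (r1.a + d) % 5) (hb : r.b % 5 = (r1.b + d) % 5) (hc : r.c % 5 = (r1.c + d) % 5)
    (hd' : r.d % 5 = (r1.d + d) % 5) (he : r.e % 5 = (r1.e + d) % 5) : r ∈ candRows r1 := by
  obtain ⟨a, b, c, d5, e⟩ := r
  simp only [Row5.sum] at hs
  simp only at ha hb hc hd' he
  simp only [candRows, List.mem_flatMap, List.mem_range]
  refine ⟨d, hd, ?_⟩
  have hsum : (shiftBase r1 d).sum ≤ 18 ∧ (18 - (shiftBase r1 d).sum) % 5 = 0 := by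
    simp only [shiftBase, Row5.sum]; omega
  simp only [liftRows, if_pos hsum, List.mem_map]
  refine ⟨⟨a / 5, b / 5, c / 5, d5 / 5, e / 5⟩, ?_, ?_⟩
  · apply mem_comps5
    simp only [Row5.sum, shiftBase]; omega
  · simp only [shiftBase, Row5.mk.injEq]; omega

/-- The `2 × 2` block test for two rows: every pair of columns has block sum in `[8, 16]`. -/
def compat5 (r s : Row5) : Bool :=
  (8 ≤ r.a + r.b + s.a + s.b && r.a + r.b + s.a + s.b ≤ 16) && (8 ≤ r.a + r.c + s.a + s.c && r.a + r.c + s.a + s.c ≤ 16) &&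
  (8 ≤ r.a + r.d + s.a + s.d && r.a + r.d + s.a + s.d ≤ 16) && (8 ≤ r.a + r.e + s.a + s.e && r.a + r.e + s.a + s.e ≤ 16) &&
  (8 ≤ r.b + r.c + s.b + s.c && r.b + r.c + s.b + s.c ≤ 16) && (8 ≤ r.b + r.d + s.b + s.d && r.b + r.d + s.b + s.d ≤ 16) &&
  (8 ≤ r.b + r.e + s.b + s.e && r.b + r.e + s.b + s.e ≤ 16) && (8 ≤ r.c + r.d + s.c + s.d && r.c + r.d + s.c + s.d ≤ 16) &&
  (8 ≤ r.c + r.e + s.c + s.e && r.c + r.e + s.c + s.e ≤ 16) && (8 ≤ r.d + r.e + s.d + s.e && r.d + r.e + s.d + s.e ≤ 16)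

/-- All five column sums equal `18`. -/
def colOK5 (r1 r2 r3 r4 r5 : Row5) : Bool :=
  r1.a + r2.a + r3.a + r4.a + r5.a = 18 && r1.b + r2.b + r3.b + r4.b + r5.b = 18 && r1.c + r2.c + r3.c + r4.c + r5.c = 18 &&
    r1.d + r2.d + r3.d + r4.d + r5.d = 18 && r1.e + r2.e + r3.e + r4.e + r5.e = 18

set_option maxRecDepth 100000 in
set_option maxHeartbeats 4000000 in
/-- **The enumeration.** No sorted first row of sum `18` with entries `≤ 9` extends by four pairwise block-compatible candidate rows
to a matrix with column sums `18`. -/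
theorem core5 : ∀ r1 ∈ sortedRows18, ∀ r2 ∈ candRows r1, compat5 r1 r2 = true →
    ∀ r3 ∈ candRows r1, compat5 r1 r3 = true → compat5 r2 r3 = true →
    ∀ r4 ∈ candRows r1, compat5 r1 r4 = true → compat5 r2 r4 = true → compat5 r3 r4 = true →
    ∀ r5 ∈ candRows r1, compat5 r1 r5 = true → compat5 r2 r5 = true → compat5 r3 r5 = true → compat5 r4 r5 = true →
    colOK5 r1 r2 r3 r4 r5 = false := by
  decide +kernel

/-- The n-form with a sorted first row. -/
theorem no_nMatrix5_sorted (n : Fin 5 → Fin 5 → ℕ) (hrow : ∀ i, n i 0 + n i 1 + n i 2 + n i 3 + n i 4 = 18)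
    (hcol : ∀ j, n 0 j + n 1 j + n 2 j + n 3 j + n 4 j = 18)
    (hblk : ∀ i i' j j', i ≠ i' → j ≠ j' → 8 ≤ n i j + n i j' + n i' j + n i' j' ∧ n i j + n i j' + n i' j + n i' j' ≤ 16)
    (hadd : ∀ i i' j j', (n i j + n i' j') % 5 = (n i j' + n i' j) % 5)
    (hsort : n 0 0 ≤ n 0 1 ∧ n 0 1 ≤ n 0 2 ∧ n 0 2 ≤ n 0 3 ∧ n 0 3 ≤ n 0 4) : False := by
  let ρ : Fin 5 → Row5 := fun i => ⟨n i 0, n i 1, n i 2, n i 3, n i 4⟩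
  have hcompat : ∀ i i', i ≠ i' → compat5 (ρ i) (ρ i') = true := by
    intro i i' h
    have h01 := hblk i i' 0 1 h (by decide); have h02 := hblk i i' 0 2 h (by decide); have h03 := hblk i i' 0 3 h (by decide)
    have h04 := hblk i i' 0 4 h (by decide); have h12 := hblk i i' 1 2 h (by decide); have h13 := hblk i i' 1 3 h (by decide)
    have h14 := hblk i i' 1 4 h (by decide); have h23 := hblk i i' 2 3 h (by decide); have h24 := hblk i i' 2 4 h (by decide)
    have h34 := hblk i i' 3 4 h (by decide)
    simp only [compat5, ρ, Bool.and_eq_true, decide_eq_true_eq]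
    omega
  -- the largest entry of the (sorted) first row is at most 9 (strip argument with the second row)
  have h9 : n 0 4 ≤ 9 := by
    have r0 := hrow 0; have r1 := hrow 1
    have ne : (0 : Fin 5) ≠ 1 := by decide
    have h01 := hblk 0 1 0 1 ne (by decide); have h02 := hblk 0 1 0 2 ne (by decide); have h03 := hblk 0 1 0 3 ne (by decide)
    have h04 := hblk 0 1 0 4 ne (by decide); have h12 := hblk 0 1 1 2 ne (by decide); have h13 := hblk 0 1 1 3 ne (by decide)
    have h14 := hblk 0 1 1 4 ne (by decide); have h23 := hblk 0 1 2 3 ne (by decide); have h24 := hblk 0 1 2 4 ne (by decide)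
    have h34 := hblk 0 1 3 4 ne (by decide)
    omega
  have hmem1 : ρ 0 ∈ sortedRows18 :=
    mem_sortedRows18 _ (by simp only [Row5.sum, ρ]; exact hrow 0) hsort.1 hsort.2.1 hsort.2.2.1 hsort.2.2.2 h9
  have hcand : ∀ i, ρ i ∈ candRows (ρ 0) := by
    intro i
    refine mem_candRows (ρ 0) (ρ i) ((n i 0 + 4 * n 0 0) % 5) (Nat.mod_lt _ (by norm_num))
      (by simp only [Row5.sum, ρ]; exact hrow i) ?_ ?_ ?_ ?_ ?_
    · have := hadd i 0 0 0; simp only [ρ]; omega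
    · have := hadd i 0 1 0; simp only [ρ]; omega
    · have := hadd i 0 2 0; simp only [ρ]; omega
    · have := hadd i 0 3 0; simp only [ρ]; omega
    · have := hadd i 0 4 0; simp only [ρ]; omega
  have hcols : colOK5 (ρ 0) (ρ 1) (ρ 2) (ρ 3) (ρ 4) = true := by
    simp only [colOK5, ρ, Bool.and_eq_true, decide_eq_true_eq]
    exact ⟨⟨⟨⟨hcol 0, hcol 1⟩, hcol 2⟩, hcol 3⟩, hcol 4⟩
  have := core5 (ρ 0) hmem1 (ρ 1) (hcand 1) (hcompat 0 1 (by decide)) (ρ 2) (hcand 2) (hcompat 0 2 (by decide))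
    (hcompat 1 2 (by decide)) (ρ 3) (hcand 3) (hcompat 0 3 (by decide)) (hcompat 1 3 (by decide)) (hcompat 2 3 (by decide))
    (ρ 4) (hcand 4) (hcompat 0 4 (by decide)) (hcompat 1 4 (by decide)) (hcompat 2 4 (by decide)) (hcompat 3 4 (by decide))
  rw [hcols] at this
  exact Bool.noConfusion this

/-- **No coset-mass matrix (n-form).** No `5 × 5` matrix of naturals has all row and column sums `18`, all `2 × 2` block sums in
`[8, 16]` and all `2 × 2` contrasts `≡ 0 (mod 5)`. (Reduce to a sorted first row by a column permutation.) -/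
theorem no_nMatrix5 (n : Fin 5 → Fin 5 → ℕ) (hrow : ∀ i, ∑ j, n i j = 18) (hcol : ∀ j, ∑ i, n i j = 18)
    (hblk : ∀ i i' j j', i ≠ i' → j ≠ j' → 8 ≤ n i j + n i j' + n i' j + n i' j' ∧ n i j + n i j' + n i' j + n i' j' ≤ 16)
    (hadd : ∀ i i' j j', (n i j + n i' j') % 5 = (n i j' + n i' j) % 5) : False := by
  set σ : Equiv.Perm (Fin 5) := Tuple.sort (n 0) with hσ
  have hmono : Monotone (n 0 ∘ σ) := Tuple.monotone_sort (n 0)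
  refine no_nMatrix5_sorted (fun i j => n i (σ j)) (fun i => ?_) (fun j => ?_)
    (fun i i' j j' hi hj => hblk i i' (σ j) (σ j') hi (σ.injective.ne hj)) (fun i i' j j' => hadd i i' (σ j) (σ j')) ?_
  · have h := hrow i
    rw [← Equiv.sum_comp σ (n i)] at h
    simpa [Fin.sum_univ_five] using h
  · have h := hcol (σ j)
    simpa [Fin.sum_univ_five] using h
  · exact ⟨hmono (show (0 : Fin 5) ≤ 1 by decide), hmono (show (1 : Fin 5) ≤ 2 by decide),
      hmono (show (2 : Fin 5) ≤ 3 by decide), hmono (show (3 : Fin 5) ≤ 4 by decide)⟩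

/-- **No coset-mass matrix.** No `5 × 5` matrix of naturals has entries `≡ 2 (mod 3)`, all row and column sums `64`, all `2 × 2`
block sums in `[32, 56]`, and all `2 × 2` contrasts `≡ 0 (mod 5)`. -/
theorem no_cosetMatrix5 (N : Fin 5 → Fin 5 → ℕ) (hmod : ∀ i j, N i j % 3 = 2)
    (hrow : ∀ i, N i 0 + N i 1 + N i 2 + N i 3 + N i 4 = 64) (hcol : ∀ j, N 0 j + N 1 j + N 2 j + N 3 j + N 4 j = 64)
    (hblk : ∀ i i' j j', i ≠ i' → j ≠ j' → 32 ≤ N i j + N i j' + N i' j + N i' j' ∧ N i j + N i j' + N i' j + N i' j' ≤ 56)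
    (hadd : ∀ i i' j j', (N i j + N i' j') % 5 = (N i j' + N i' j) % 5) : False := by
  have hN : ∀ i j, N i j = 3 * (N i j / 3) + 2 := fun i j => by have := hmod i j; omega
  refine no_nMatrix5 (fun i j => N i j / 3) (fun i => ?_) (fun j => ?_) (fun i i' j j' hi hj => ?_) (fun i i' j j' => ?_)
  · have := hrow i
    have e0 := hN i 0; have e1 := hN i 1; have e2 := hN i 2; have e3 := hN i 3; have e4 := hN i 4
    rw [Fin.sum_univ_five]; omega
  · have := hcol j
    have e0 := hN 0 j; have e1 := hN 1 j; have e2 := hN 2 j; have e3 := hN 3 j; have e4 := hN 4 j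
    rw [Fin.sum_univ_five]; omega
  · have := hblk i i' j j' hi hj
    have e1 := hN i j; have e2 := hN i j'; have e3 := hN i' j; have e4 := hN i' j'
    omega
  · have := hadd i i' j j'
    have e1 := hN i j; have e2 := hN i' j'; have e3 := hN i j'; have e4 := hN i' j
    omega

end Summit.MatrixMultiplication.OmegaCensus.SmallFormats.Coset5
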